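import Summits.CriticalPhenomena.SAWScalingLimit.Theorems.SAWDefectDecoherenceBoundaryClosureRFarReduction
import HarnessLib

/-!
# Crux `BoundaryClosureR` (stmt-CriticalPhenomena-14004), line `pick-half-plane` (skeleton r5b):
the boundary half from PINCH-FREE bookkeeping and far-arrival tightness (wave 4)

Landing target:
`Summits/CriticalPhenomena/SAWScalingLimit/Theorems/SAWDefectDecoherenceBoundaryClosureRFarReduction2.lean`
(`--supports stmt-CriticalPhenomena-14004`).

Same glue as `…FarReduction.lean` (`[A] → [D] → BoundaryHalfPlaneBounds`), with the per-domain
bookkeeping hypothesis [A] weakened to PINCH-FREE flat floor segments: the segment clause gains the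
conjunct `((![k, m - 1], 0) : HexVertex) ∉ Λ` (no up-face hanging below a floor site of the
segment — allowed by simple connectivity, and fatal for the sign bookkeeping when the normaliser
sits in the hanging blob, as worker w-boundary found).  The glue is unchanged: inside the pinned
ball at the root the window segment is an exact half-lattice floor, so the hanging faces (row
`mr δ − 1`, scaled centre within `δ` of a window midpoint, hence in `ball x r`) are NOT in `Λ δ`.

* `dist_hexCenter_upBelow_hexMidpoint_floorEdge_le`: the hanging face is within `1` of the floor
  midpoint;
* `stub_halfPlaneInputs_farReduction2` (registered sub-goal, [D] at data level) and
  `halfPlaneInputs_farReduction'` (family level).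

Sources: H. Duminil-Copin, S. Smirnov, Ann. of Math. 175 (2012), §3–§4.
-/

noncomputable section

open scoped BigOperators Topology Classical
open Filter Set
open Literature.Probability.LatticeModels (HexVertex hexGraph hexCenter hexFaceVertices Site)
open Literature.Probability.RandomPlanarGeometry
open Literature.Probability.RandomPlanarGeometry.SAW
open Literature.Probability.Percolation (hexCenter_im hexCenter_re)
open Literature.Barriers.CriticalPhenomena.HexGreen (nbrs mem_nbrs_iff)
open Summit.CriticalPhenomena.SAWScalingLimit.Theorems.ObservableToSLE.FloorRatio (dist_hexCenter_hexMidpoint_le)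

namespace Summit.CriticalPhenomena.SAWScalingLimit.Theorems.PickHalfPlane.GateMass

/-! ### 17. The hanging face below a floor site -/

/-- The up-face `(k, m-1, 0)` hanging below the floor site under the cell `(k, m)` is within
distance `1` of the midpoint of the floor mid-edge below that cell (`Δre = 1/2`, `Δim = √3/3`).
[folklore] -/
theorem dist_hexCenter_upBelow_hexMidpoint_floorEdge_le (k m : ℤ) :
    dist (hexCenter (((![k, m - 1] : Site 2)), (0 : Fin 2)))
      (hexMidpoint s((((![k, m - 1] : Site 2)), (1 : Fin 2)), ((![k, m] : Site 2), (0 : Fin 2)))) ≤ 1 := by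
  rw [Complex.dist_eq, Complex.norm_def, Complex.normSq_apply, Complex.sub_re, Complex.sub_im,
    hexCenter_re, hexCenter_im, re_hexMidpoint_floorEdge', im_hexMidpoint_floorEdge']
  simp only [Matrix.cons_val_zero, Matrix.cons_val_one, Matrix.cons_val_fin_one, Fin.isValue,
    Fin.val_zero, Nat.cast_zero, Int.cast_sub, Int.cast_one]
  have h3 : Real.sqrt 3 * Real.sqrt 3 = 3 := Real.mul_self_sqrt (by norm_num)
  rw [show (1 : ℝ) = Real.sqrt 1 from Real.sqrt_one.symm]
  refine Real.sqrt_le_sqrt ?_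
  nlinarith [h3]

/-! ### 18. The glue with pinch-free bookkeeping -/

/-- **Registered sub-goal `stub_halfPlaneInputs_farReduction2`** (crux item stmt-CriticalPhenomena-14004,
line `pick-half-plane`, stub `stub_halfPlaneInputs`, boundary half, skeleton r5b; wave 4): the glue of
`stub_halfPlaneInputs_farReduction` with the bookkeeping hypothesis [A] asked only for PINCH-FREE
flat floor segments (extra conjunct `(![k, m-1], 0) ∉ Λ`: no up-face hanging below a floor site —
worker w-boundary found the pinch case breaks the sign bookkeeping), [D] unchanged, conclusion the
root-frame bound of `BoundaryHalfPlaneBounds` verbatim.  In the pinned half-lattice the window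
segment is pinch-free: the hanging face has row `mr δ − 1` and scaled centre in `ball x r`.
[cite: DuminilCopinSmirnov2012, §3–§4 (boundary arrival masses; the map H with dH = F dz)] -/
theorem stub_halfPlaneInputs_farReduction2 :
    (∃ K : ℝ, ∀ (Λ : Finset HexVertex), hexDomainSimplyConnected Λ →
        (hexGraph.induce ((Λ : Finset HexVertex) : Set HexVertex)).Preconnected →
      ∀ (m k₁ k₂ ka : ℤ),
        (∀ k : ℤ, k₁ ≤ k → k ≤ k₂ → ((![k, m], 0) : HexVertex) ∈ Λ ∧
          ((![k, m - 1], 1) : HexVertex) ∉ Λ ∧ (k < k₂ → ((![k, m], 1) : HexVertex) ∈ Λ) ∧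
          ((![k, m - 1], 0) : HexVertex) ∉ Λ) →
        k₁ ≤ ka → ka ≤ k₂ →
      ∀ (ub wb : HexVertex), hexGraph.Adj ub wb → ub ∉ Λ → wb ∈ Λ →
        (∀ k : ℤ, k₁ ≤ k → k ≤ k₂ → s(ub, wb) ≠ s((((![k, m - 1] : Site 2)), (1 : Fin 2)), ((![k, m] : Site 2), (0 : Fin 2)))) →
      ∀ (H : Site 2 → ℂ), IsPotential Λ s((((![ka, m - 1] : Site 2)), (1 : Fin 2)), ((![ka, m] : Site 2), (0 : Fin 2))) H →
      ∀ (sb : Site 2), sb ∈ hexFaceVertices ub → sb ∈ hexFaceVertices wb →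
      ∀ (s : Site 2), IsLatticeSite Λ s → ¬ IsInteriorSite Λ s →
        (H s).re - (H sb).re ≤ K * ∑ v ∈ Λ, ∑ t ∈ (nbrs v).filter (· ∉ Λ),
          if (∀ k : ℤ, k₁ ≤ k → k ≤ k₂ → s(t, v) ≠ s((((![k, m - 1] : Site 2)), (1 : Fin 2)), ((![k, m] : Site 2), (0 : Fin 2))))
          then ‖hexParafermionicObservable Λ s((((![ka, m - 1] : Site 2)), (1 : Fin 2)), ((![ka, m] : Site 2), (0 : Fin 2))) hexCriticalFugacity 0 s(t, v)‖ else 0) →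
    ∀ (D : DobrushinDomain) (ρ : ℝ) (Λ : ℝ → Finset HexVertex) (m : ℝ → ℤ) (b : ℝ → Sym2 HexVertex),
      (0 < ρ ∧
      D.carrier ∩ Metric.ball (D.pt 1) ρ = {z : ℂ | (D.pt 1).im < z.im} ∩ Metric.ball (D.pt 1) ρ ∧
      (∀ᶠ δ : ℝ in 𝓝[>] 0, hexDomainSimplyConnected (Λ δ) ∧ b δ ∈ hexDomainBoundary (Λ δ) ∧
          (hexGraph.induce ((Λ δ : Finset HexVertex) : Set HexVertex)).Preconnected ∧
          (∀ v ∈ Λ δ, (δ : ℂ) * hexCenter v ∈ D.carrier) ∧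
          (∀ v : HexVertex, (δ : ℂ) * hexCenter v ∈ Metric.ball (D.pt 1) ρ → (v ∈ Λ δ ↔ m δ ≤ v.1 1))) ∧
      (∀ K : Set ℂ, IsCompact K → K ⊆ D.carrier →
          ∀ᶠ δ : ℝ in 𝓝[>] 0, ∀ v : HexVertex, (δ : ℂ) * hexCenter v ∈ K → v ∈ Λ δ) ∧
      Tendsto (fun δ : ℝ => (δ : ℂ) * hexMidpoint (b δ)) (𝓝[>] 0) (𝓝 (D.pt 1))) →
    ∀ (x : ℂ) (e : ℝ → Sym2 HexVertex) (r : ℝ) (mr : ℝ → ℤ),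
      (0 < r ∧
      D.carrier ∩ Metric.ball x r = {z : ℂ | x.im < z.im} ∩ Metric.ball x r ∧
      (∀ᶠ δ : ℝ in 𝓝[>] 0, e δ ∈ hexDomainBoundary (Λ δ) ∧ Nonempty (HexMidEdgeSAW (Λ δ) (e δ) (b δ)) ∧
          (∀ v : HexVertex, (δ : ℂ) * hexCenter v ∈ Metric.ball x r → (v ∈ Λ δ ↔ mr δ ≤ v.1 1))) ∧
      Tendsto (fun δ : ℝ => (δ : ℂ) * hexMidpoint (e δ)) (𝓝[>] 0) (𝓝 x)) → x ≠ D.pt 1 →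
    (∃ C : ℝ, ∀ᶠ δ : ℝ in 𝓝[>] 0,
      δ * (∑ v ∈ Λ δ, ∑ t ∈ (nbrs v).filter (· ∉ Λ δ),
          if (δ : ℂ) * hexMidpoint s(t, v) ∉ Metric.ball x (min r ‖x - D.pt 1‖ / 2)
          then ‖hexParafermionicObservable (Λ δ) (e δ) hexCriticalFugacity 0 s(t, v)‖ else 0) ≤
        C * ‖hexParafermionicObservable (Λ δ) (e δ) hexCriticalFugacity 0 (b δ)‖) →
    ∃ M : ℝ, ∀ᶠ δ : ℝ in 𝓝[>] 0, ∀ H : Site 2 → ℂ, IsPotential (Λ δ) (e δ) H →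
      ∀ (ub wb : HexVertex), b δ = s(ub, wb) →
      ∀ sb : Site 2, sb ∈ hexFaceVertices ub → sb ∈ hexFaceVertices wb →
      ∀ s : Site 2, IsLatticeSite (Λ δ) s → ¬ IsInteriorSite (Λ δ) s →
        δ * ((H s).re - (H sb).re) ≤
          M * ‖hexParafermionicObservable (Λ δ) (e δ) hexCriticalFugacity 0 (b δ)‖ := by
  intro hA D ρ Λ m b hAF x e r mr hPR hx hF
  obtain ⟨K, hK⟩ := hA
  obtain ⟨C, hC⟩ := hF
  refine ⟨max K 0 * max C 0, ?_⟩
  -- the data of the two bundles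
  have hr : 0 < r := hPR.1
  have hd : 0 < ‖x - D.pt 1‖ := norm_pos_iff.2 (sub_ne_zero.2 hx)
  set r₀ : ℝ := min r ‖x - D.pt 1‖ / 2 with hr₀
  have hr₀pos : 0 < r₀ := by positivity
  have hr₀r : r₀ ≤ r / 2 := by
    have := min_le_left r ‖x - D.pt 1‖; rw [hr₀]; linarith
  have hr₀d : r₀ ≤ ‖x - D.pt 1‖ / 2 := by
    have := min_le_right r ‖x - D.pt 1‖; rw [hr₀]; linarith
  have hpin : ∀ᶠ δ : ℝ in 𝓝[>] 0, ∀ v : HexVertex,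
      (δ : ℂ) * hexCenter v ∈ Metric.ball x r → (v ∈ Λ δ ↔ mr δ ≤ v.1 1) :=
    hPR.2.2.1.mono fun δ hδ => hδ.2.2
  have he : ∀ᶠ δ : ℝ in 𝓝[>] 0, e δ ∈ hexDomainBoundary (Λ δ) := hPR.2.2.1.mono fun δ hδ => hδ.1
  -- eventually: the root is a floor dart of row `mr δ`, near `x`; the normaliser is far from `x`
  have hroot := eventually_exists_eq_floorEdge hr hpin he hPR.2.2.2
  have heball : ∀ᶠ δ : ℝ in 𝓝[>] 0, (δ : ℂ) * hexMidpoint (e δ) ∈ Metric.ball x r₀ :=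
    hPR.2.2.2 (Metric.ball_mem_nhds x hr₀pos)
  have hbfar : ∀ᶠ δ : ℝ in 𝓝[>] 0, (δ : ℂ) * hexMidpoint (b δ) ∉ Metric.ball x r₀ := by
    have h1 : ∀ᶠ δ : ℝ in 𝓝[>] 0, (δ : ℂ) * hexMidpoint (b δ) ∈
        Metric.ball (D.pt 1) (‖x - D.pt 1‖ / 2) := hAF.2.2.2.2 (Metric.ball_mem_nhds _ (half_pos hd))
    filter_upwards [h1] with δ hδ hmem
    rw [Metric.mem_ball, Complex.dist_eq] at hδ hmem
    have htri : ‖x - D.pt 1‖ ≤ ‖(δ : ℂ) * hexMidpoint (b δ) - x‖ + ‖(δ : ℂ) * hexMidpoint (b δ) - D.pt 1‖ := by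
      calc ‖x - D.pt 1‖ = ‖((δ : ℂ) * hexMidpoint (b δ) - D.pt 1) - ((δ : ℂ) * hexMidpoint (b δ) - x)‖ := by
            congr 1; ring
        _ ≤ _ := by rw [add_comm]; exact norm_sub_le _ _
    linarith
  have hsmall : ∀ᶠ δ : ℝ in 𝓝[>] 0, 0 < δ ∧ δ < r / 2 := by
    have h1 : ∀ᶠ δ : ℝ in 𝓝[>] 0, δ ∈ Set.Ioo 0 (r / 2) := Ioo_mem_nhdsGT (half_pos hr)
    exact h1
  filter_upwards [hpin, hroot, heball, hbfar, hsmall, hAF.2.2.1, hC] with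
    δ hpinδ hrootδ heδ hbδ hδ hadmδ hCδ
  obtain ⟨ka, hka⟩ := hrootδ
  rw [hka] at heδ hCδ
  rw [hka]
  intro H hH ub wb hb sb hsb1 hsb2 s hs hns
  -- the window of columns whose scaled floor midpoints lie in `ball x r₀`
  have hS : ∀ z ∈ Metric.ball x r₀, dist z x + δ / 2 < r := by
    intro z hz
    have h1 : dist z x < r₀ := hz
    linarith
  have hW := boundaryWindow_eq_image (m := mr δ) (S := Metric.ball x r₀) hδ.1.le hpinδ hS
  have hWfin := finite_intWindow (m := mr δ) (S := Metric.ball x r₀) hδ.1.le hpinδ hS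
  set W : Finset ℤ := hWfin.toFinset with hWdef
  have hmemW : ∀ k : ℤ, k ∈ W ↔ (δ : ℂ) * hexMidpoint s((((![k, mr δ - 1] : Site 2)), (1 : Fin 2)), ((![k, mr δ] : Site 2), (0 : Fin 2))) ∈ Metric.ball x r₀ :=
    fun k => by rw [hWdef, Set.Finite.mem_toFinset, Set.mem_setOf_eq]
  have hkaW : ka ∈ W := (hmemW ka).2 heδ
  have hWne : W.Nonempty := ⟨ka, hkaW⟩
  set k₁ : ℤ := W.min' hWne with hk₁
  set k₂ : ℤ := W.max' hWne with hk₂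
  have hk₁ka : k₁ ≤ ka := Finset.min'_le W ka hkaW
  have hkak₂ : ka ≤ k₂ := Finset.le_max' W ka hkaW
  have hk₁W : k₁ ∈ W := Finset.min'_mem W hWne
  have hk₂W : k₂ ∈ W := Finset.max'_mem W hWne
  -- the segment `k₁ … k₂` IS the window
  have hseg : ∀ k : ℤ, k₁ ≤ k → k ≤ k₂ →
      (δ : ℂ) * hexMidpoint s((((![k, mr δ - 1] : Site 2)), (1 : Fin 2)), ((![k, mr δ] : Site 2), (0 : Fin 2))) ∈ Metric.ball x r₀ :=
    fun k h1 h2 => smul_hexMidpoint_floorEdge_mem_ball_of_between hδ.1.le ((hmemW k₁).1 hk₁W)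
      ((hmemW k₂).1 hk₂W) h1 h2
  have hwin : ∀ k : ℤ, (δ : ℂ) * hexMidpoint s((((![k, mr δ - 1] : Site 2)), (1 : Fin 2)), ((![k, mr δ] : Site 2), (0 : Fin 2))) ∈ Metric.ball x r₀ →
      k₁ ≤ k ∧ k ≤ k₂ :=
    fun k hk => ⟨Finset.min'_le W k ((hmemW k).2 hk), Finset.le_max' W k ((hmemW k).2 hk)⟩
  -- faces near the window lie in the pinned ball
  have hnear : ∀ (w : HexVertex) (k : ℤ), k₁ ≤ k → k ≤ k₂ →
      dist (hexCenter w) (hexMidpoint s((((![k, mr δ - 1] : Site 2)), (1 : Fin 2)), ((![k, mr δ] : Site 2), (0 : Fin 2)))) ≤ 1 →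
      (δ : ℂ) * hexCenter w ∈ Metric.ball x r := by
    intro w k h1 h2 hdist
    have hmid : dist ((δ : ℂ) * hexMidpoint s((((![k, mr δ - 1] : Site 2)), (1 : Fin 2)), ((![k, mr δ] : Site 2), (0 : Fin 2)))) x < r₀ := hseg k h1 h2
    rw [Metric.mem_ball]
    have h3 : dist ((δ : ℂ) * hexCenter w) ((δ : ℂ) * hexMidpoint s((((![k, mr δ - 1] : Site 2)), (1 : Fin 2)), ((![k, mr δ] : Site 2), (0 : Fin 2)))) ≤ δ := by
      rw [Complex.dist_eq, ← mul_sub, norm_mul, Complex.norm_real, Real.norm_of_nonneg hδ.1.le,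
        ← Complex.dist_eq]
      nlinarith [hδ.1]
    calc dist ((δ : ℂ) * hexCenter w) x
        ≤ dist ((δ : ℂ) * hexCenter w) ((δ : ℂ) * hexMidpoint s((((![k, mr δ - 1] : Site 2)), (1 : Fin 2)), ((![k, mr δ] : Site 2), (0 : Fin 2)))) +
          dist ((δ : ℂ) * hexMidpoint s((((![k, mr δ - 1] : Site 2)), (1 : Fin 2)), ((![k, mr δ] : Site 2), (0 : Fin 2)))) x := dist_triangle _ _ _
      _ < r := by linarith
  -- the segment is an exact flat floor of `Λ δ`
  have hflat : ∀ k : ℤ, k₁ ≤ k → k ≤ k₂ → ((![k, mr δ], 0) : HexVertex) ∈ Λ δ ∧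
      ((![k, mr δ - 1], 1) : HexVertex) ∉ Λ δ ∧ (k < k₂ → ((![k, mr δ], 1) : HexVertex) ∈ Λ δ) ∧
      ((![k, mr δ - 1], 0) : HexVertex) ∉ Λ δ := by
    intro k h1 h2
    have hup : (δ : ℂ) * hexCenter (((![k, mr δ] : Site 2)), (0 : Fin 2)) ∈ Metric.ball x r :=
      hnear _ k h1 h2 ((dist_hexCenter_hexMidpoint_le (floorEdge_mem_edgeSet k (mr δ))
        (Sym2.mem_mk_right _ _)).trans (by norm_num))
    have hdown : (δ : ℂ) * hexCenter (((![k, mr δ - 1] : Site 2)), (1 : Fin 2)) ∈ Metric.ball x r :=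
      hnear _ k h1 h2 ((dist_hexCenter_hexMidpoint_le (floorEdge_mem_edgeSet k (mr δ))
        (Sym2.mem_mk_left _ _)).trans (by norm_num))
    have hmid : (δ : ℂ) * hexCenter (((![k, mr δ] : Site 2)), (1 : Fin 2)) ∈ Metric.ball x r :=
      hnear _ k h1 h2 (dist_hexCenter_down_hexMidpoint_floorEdge_le k (mr δ))
    have hhang : (δ : ℂ) * hexCenter (((![k, mr δ - 1] : Site 2)), (0 : Fin 2)) ∈ Metric.ball x r :=
      hnear _ k h1 h2 (dist_hexCenter_upBelow_hexMidpoint_floorEdge_le k (mr δ))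
    refine ⟨(hpinδ _ hup).2 (by simp), fun h => ?_, fun _ => (hpinδ _ hmid).2 (by simp), fun h => ?_⟩
    · have := (hpinδ _ hdown).1 h
      simp at this
    · have := (hpinδ _ hhang).1 h
      simp at this
  -- the normaliser: a boundary dart off the segment
  obtain ⟨hbedge, u, v, hbuv, hv, hu⟩ := hadmδ.2.1
  have huv : hexGraph.Adj u v := by
    have h := hbedge; rw [hbuv] at h; exact (SimpleGraph.mem_edgeSet hexGraph).1 h
  have hboff : ∀ k : ℤ, k₁ ≤ k → k ≤ k₂ → b δ ≠ s((((![k, mr δ - 1] : Site 2)), (1 : Fin 2)), ((![k, mr δ] : Site 2), (0 : Fin 2))) := by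
    intro k h1 h2 heq
    exact hbδ (heq ▸ hseg k h1 h2)
  -- bookkeeping [A] at this mesh, for either orientation of the normaliser dart
  have key : (H s).re - (H sb).re ≤ K * ∑ v ∈ Λ δ, ∑ t ∈ (nbrs v).filter (· ∉ Λ δ),
      (if (∀ k : ℤ, k₁ ≤ k → k ≤ k₂ → s(t, v) ≠ s((((![k, mr δ - 1] : Site 2)), (1 : Fin 2)), ((![k, mr δ] : Site 2), (0 : Fin 2))))
        then ‖hexParafermionicObservable (Λ δ) s((((![ka, mr δ - 1] : Site 2)), (1 : Fin 2)), ((![ka, mr δ] : Site 2), (0 : Fin 2))) hexCriticalFugacity 0 s(t, v)‖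
        else 0) := by
    rcases Sym2.eq_iff.1 (hb.symm.trans hbuv) with ⟨rfl, rfl⟩ | ⟨rfl, rfl⟩
    · exact hK (Λ δ) hadmδ.1 hadmδ.2.2.1 (mr δ) k₁ k₂ ka hflat hk₁ka hkak₂ ub wb huv hu hv
        (fun k h1 h2 => (hb ▸ hboff k h1 h2 :)) H hH sb hsb1 hsb2 s hs hns
    · exact hK (Λ δ) hadmδ.1 hadmδ.2.2.1 (mr δ) k₁ k₂ ka hflat hk₁ka hkak₂ wb ub huv hu hv
        (fun k h1 h2 heq => hboff k h1 h2 (hb.trans (Sym2.eq_swap.trans heq))) H hH sb hsb2 hsb1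
        s hs hns
  -- the off-segment sum is dominated termwise by the far sum
  have hdom : (∑ v ∈ Λ δ, ∑ t ∈ (nbrs v).filter (· ∉ Λ δ),
      (if (∀ k : ℤ, k₁ ≤ k → k ≤ k₂ → s(t, v) ≠ s((((![k, mr δ - 1] : Site 2)), (1 : Fin 2)), ((![k, mr δ] : Site 2), (0 : Fin 2))))
        then ‖hexParafermionicObservable (Λ δ) s((((![ka, mr δ - 1] : Site 2)), (1 : Fin 2)), ((![ka, mr δ] : Site 2), (0 : Fin 2))) hexCriticalFugacity 0 s(t, v)‖
        else 0)) ≤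
      ∑ v ∈ Λ δ, ∑ t ∈ (nbrs v).filter (· ∉ Λ δ),
        (if (δ : ℂ) * hexMidpoint s(t, v) ∉ Metric.ball x (min r ‖x - D.pt 1‖ / 2)
          then ‖hexParafermionicObservable (Λ δ) s((((![ka, mr δ - 1] : Site 2)), (1 : Fin 2)), ((![ka, mr δ] : Site 2), (0 : Fin 2))) hexCriticalFugacity 0 s(t, v)‖
          else 0) := by
    refine Finset.sum_le_sum fun v hv => Finset.sum_le_sum fun t ht => ?_
    rw [Finset.mem_filter, mem_nbrs_iff] at ht
    by_cases hoff : ∀ k : ℤ, k₁ ≤ k → k ≤ k₂ → s(t, v) ≠ s((((![k, mr δ - 1] : Site 2)), (1 : Fin 2)), ((![k, mr δ] : Site 2), (0 : Fin 2)))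
    · rw [if_pos hoff, if_pos]
      intro hin
      -- a boundary dart with scaled midpoint in the window ball is ON the segment
      have hbd : s(t, v) ∈ {e' : Sym2 HexVertex | e' ∈ hexDomainBoundary (Λ δ) ∧
          (δ : ℂ) * hexMidpoint e' ∈ Metric.ball x r₀} :=
        ⟨⟨(SimpleGraph.mem_edgeSet hexGraph).2 ht.1.symm, t, v, rfl, hv, ht.2⟩, hin⟩
      rw [hW] at hbd
      obtain ⟨k, hk, hkeq⟩ := hbd
      obtain ⟨h1, h2⟩ := hwin k hk
      exact hoff k h1 h2 hkeq.symm
    · rw [if_neg hoff]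
      split_ifs <;> positivity
  -- assemble
  have hZb : 0 ≤ ‖hexParafermionicObservable (Λ δ) s((((![ka, mr δ - 1] : Site 2)), (1 : Fin 2)), ((![ka, mr δ] : Site 2), (0 : Fin 2))) hexCriticalFugacity 0 (b δ)‖ :=
    norm_nonneg _
  have hoff_nonneg : 0 ≤ ∑ v ∈ Λ δ, ∑ t ∈ (nbrs v).filter (· ∉ Λ δ),
      (if (∀ k : ℤ, k₁ ≤ k → k ≤ k₂ → s(t, v) ≠ s((((![k, mr δ - 1] : Site 2)), (1 : Fin 2)), ((![k, mr δ] : Site 2), (0 : Fin 2))))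
        then ‖hexParafermionicObservable (Λ δ) s((((![ka, mr δ - 1] : Site 2)), (1 : Fin 2)), ((![ka, mr δ] : Site 2), (0 : Fin 2))) hexCriticalFugacity 0 s(t, v)‖
        else 0) :=
    Finset.sum_nonneg fun v _ => Finset.sum_nonneg fun t _ => by
      split_ifs <;> positivity
  have hfar_nonneg : 0 ≤ ∑ v ∈ Λ δ, ∑ t ∈ (nbrs v).filter (· ∉ Λ δ),
      (if (δ : ℂ) * hexMidpoint s(t, v) ∉ Metric.ball x (min r ‖x - D.pt 1‖ / 2)
        then ‖hexParafermionicObservable (Λ δ) s((((![ka, mr δ - 1] : Site 2)), (1 : Fin 2)), ((![ka, mr δ] : Site 2), (0 : Fin 2))) hexCriticalFugacity 0 s(t, v)‖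
        else 0) :=
    Finset.sum_nonneg fun v _ => Finset.sum_nonneg fun t _ => by
      split_ifs <;> positivity
  have hK0 : K ≤ max K 0 := le_max_left _ _
  have hC0 : C ≤ max C 0 := le_max_left _ _
  calc δ * ((H s).re - (H sb).re)
      ≤ δ * (max K 0 * ∑ v ∈ Λ δ, ∑ t ∈ (nbrs v).filter (· ∉ Λ δ),
          (if (∀ k : ℤ, k₁ ≤ k → k ≤ k₂ → s(t, v) ≠ s((((![k, mr δ - 1] : Site 2)), (1 : Fin 2)), ((![k, mr δ] : Site 2), (0 : Fin 2))))
            then ‖hexParafermionicObservable (Λ δ) s((((![ka, mr δ - 1] : Site 2)), (1 : Fin 2)), ((![ka, mr δ] : Site 2), (0 : Fin 2))) hexCriticalFugacity 0 s(t, v)‖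
            else 0)) := by
        refine mul_le_mul_of_nonneg_left (key.trans ?_) hδ.1.le
        exact mul_le_mul_of_nonneg_right hK0 hoff_nonneg
    _ ≤ max K 0 * (δ * ∑ v ∈ Λ δ, ∑ t ∈ (nbrs v).filter (· ∉ Λ δ),
          (if (δ : ℂ) * hexMidpoint s(t, v) ∉ Metric.ball x (min r ‖x - D.pt 1‖ / 2)
            then ‖hexParafermionicObservable (Λ δ) s((((![ka, mr δ - 1] : Site 2)), (1 : Fin 2)), ((![ka, mr δ] : Site 2), (0 : Fin 2))) hexCriticalFugacity 0 s(t, v)‖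
            else 0)) := by
        rw [mul_left_comm]
        exact mul_le_mul_of_nonneg_left (mul_le_mul_of_nonneg_left hdom hδ.1.le) (le_max_right _ _)
    _ ≤ max K 0 * (C * ‖hexParafermionicObservable (Λ δ) s((((![ka, mr δ - 1] : Site 2)), (1 : Fin 2)), ((![ka, mr δ] : Site 2), (0 : Fin 2))) hexCriticalFugacity 0 (b δ)‖) :=
        mul_le_mul_of_nonneg_left hCδ (le_max_right _ _)
    _ ≤ max K 0 * (max C 0 * ‖hexParafermionicObservable (Λ δ) s((((![ka, mr δ - 1] : Site 2)), (1 : Fin 2)), ((![ka, mr δ] : Site 2), (0 : Fin 2))) hexCriticalFugacity 0 (b δ)‖) :=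
        mul_le_mul_of_nonneg_left (mul_le_mul_of_nonneg_right hC0 hZb) (le_max_right _ _)
    _ = max K 0 * max C 0 *
          ‖hexParafermionicObservable (Λ δ) s((((![ka, mr δ - 1] : Site 2)), (1 : Fin 2)), ((![ka, mr δ] : Site 2), (0 : Fin 2))) hexCriticalFugacity 0 (b δ)‖ := by ring

/-- **The family-level glue `[A'] → [D] → BoundaryHalfPlaneBounds`** (wave 4; [A'] = bookkeeping for
pinch-free segments, [D] = far-arrival tightness, both hypotheses under the skeleton's binders with
`AdmissibleFamily` / `PinnedFlatRoot` written out; conclusion verbatim the body of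
`…PickHalfPlane.BoundaryHalfPlaneBounds`, r5b): `exact halfPlaneInputs_farReduction' hA hD`.
[cite: DuminilCopinSmirnov2012, §3–§4 (boundary arrival masses; the map H with dH = F dz)] -/
theorem halfPlaneInputs_farReduction'
    (hA : (∃ K : ℝ, ∀ (Λ : Finset HexVertex), hexDomainSimplyConnected Λ →
        (hexGraph.induce ((Λ : Finset HexVertex) : Set HexVertex)).Preconnected →
      ∀ (m k₁ k₂ ka : ℤ),
        (∀ k : ℤ, k₁ ≤ k → k ≤ k₂ → ((![k, m], 0) : HexVertex) ∈ Λ ∧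
          ((![k, m - 1], 1) : HexVertex) ∉ Λ ∧ (k < k₂ → ((![k, m], 1) : HexVertex) ∈ Λ) ∧
          ((![k, m - 1], 0) : HexVertex) ∉ Λ) →
        k₁ ≤ ka → ka ≤ k₂ →
      ∀ (ub wb : HexVertex), hexGraph.Adj ub wb → ub ∉ Λ → wb ∈ Λ →
        (∀ k : ℤ, k₁ ≤ k → k ≤ k₂ → s(ub, wb) ≠ s((((![k, m - 1] : Site 2)), (1 : Fin 2)), ((![k, m] : Site 2), (0 : Fin 2)))) →
      ∀ (H : Site 2 → ℂ), IsPotential Λ s((((![ka, m - 1] : Site 2)), (1 : Fin 2)), ((![ka, m] : Site 2), (0 : Fin 2))) H →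
      ∀ (sb : Site 2), sb ∈ hexFaceVertices ub → sb ∈ hexFaceVertices wb →
      ∀ (s : Site 2), IsLatticeSite Λ s → ¬ IsInteriorSite Λ s →
        (H s).re - (H sb).re ≤ K * ∑ v ∈ Λ, ∑ t ∈ (nbrs v).filter (· ∉ Λ),
          if (∀ k : ℤ, k₁ ≤ k → k ≤ k₂ → s(t, v) ≠ s((((![k, m - 1] : Site 2)), (1 : Fin 2)), ((![k, m] : Site 2), (0 : Fin 2))))
          then ‖hexParafermionicObservable Λ s((((![ka, m - 1] : Site 2)), (1 : Fin 2)), ((![ka, m] : Site 2), (0 : Fin 2))) hexCriticalFugacity 0 s(t, v)‖ else 0))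
    (hD : (∀ (D : DobrushinDomain) (ρ : ℝ) (Λ : ℝ → Finset HexVertex) (m : ℝ → ℤ)
      (b : ℝ → Sym2 HexVertex),
      (0 < ρ ∧
      D.carrier ∩ Metric.ball (D.pt 1) ρ = {z : ℂ | (D.pt 1).im < z.im} ∩ Metric.ball (D.pt 1) ρ ∧
      (∀ᶠ δ : ℝ in 𝓝[>] 0, hexDomainSimplyConnected (Λ δ) ∧ b δ ∈ hexDomainBoundary (Λ δ) ∧
          (hexGraph.induce ((Λ δ : Finset HexVertex) : Set HexVertex)).Preconnected ∧
          (∀ v ∈ Λ δ, (δ : ℂ) * hexCenter v ∈ D.carrier) ∧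
          (∀ v : HexVertex, (δ : ℂ) * hexCenter v ∈ Metric.ball (D.pt 1) ρ → (v ∈ Λ δ ↔ m δ ≤ v.1 1))) ∧
      (∀ K : Set ℂ, IsCompact K → K ⊆ D.carrier →
          ∀ᶠ δ : ℝ in 𝓝[>] 0, ∀ v : HexVertex, (δ : ℂ) * hexCenter v ∈ K → v ∈ Λ δ) ∧
      Tendsto (fun δ : ℝ => (δ : ℂ) * hexMidpoint (b δ)) (𝓝[>] 0) (𝓝 (D.pt 1))) →
      ∀ (x : ℂ) (e : ℝ → Sym2 HexVertex) (r : ℝ) (mr : ℝ → ℤ),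
      (0 < r ∧
      D.carrier ∩ Metric.ball x r = {z : ℂ | x.im < z.im} ∩ Metric.ball x r ∧
      (∀ᶠ δ : ℝ in 𝓝[>] 0, e δ ∈ hexDomainBoundary (Λ δ) ∧ Nonempty (HexMidEdgeSAW (Λ δ) (e δ) (b δ)) ∧
          (∀ v : HexVertex, (δ : ℂ) * hexCenter v ∈ Metric.ball x r → (v ∈ Λ δ ↔ mr δ ≤ v.1 1))) ∧
      Tendsto (fun δ : ℝ => (δ : ℂ) * hexMidpoint (e δ)) (𝓝[>] 0) (𝓝 x)) → x ≠ D.pt 1 →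
      (∃ C : ℝ, ∀ᶠ δ : ℝ in 𝓝[>] 0,
      δ * (∑ v ∈ Λ δ, ∑ t ∈ (nbrs v).filter (· ∉ Λ δ),
          if (δ : ℂ) * hexMidpoint s(t, v) ∉ Metric.ball x (min r ‖x - D.pt 1‖ / 2)
          then ‖hexParafermionicObservable (Λ δ) (e δ) hexCriticalFugacity 0 s(t, v)‖ else 0) ≤
        C * ‖hexParafermionicObservable (Λ δ) (e δ) hexCriticalFugacity 0 (b δ)‖))) :
    ∀ (D : DobrushinDomain) (ρ : ℝ) (Λ : ℝ → Finset HexVertex) (m : ℝ → ℤ) (b : ℝ → Sym2 HexVertex),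
      (0 < ρ ∧
      D.carrier ∩ Metric.ball (D.pt 1) ρ = {z : ℂ | (D.pt 1).im < z.im} ∩ Metric.ball (D.pt 1) ρ ∧
      (∀ᶠ δ : ℝ in 𝓝[>] 0, hexDomainSimplyConnected (Λ δ) ∧ b δ ∈ hexDomainBoundary (Λ δ) ∧
          (hexGraph.induce ((Λ δ : Finset HexVertex) : Set HexVertex)).Preconnected ∧
          (∀ v ∈ Λ δ, (δ : ℂ) * hexCenter v ∈ D.carrier) ∧
          (∀ v : HexVertex, (δ : ℂ) * hexCenter v ∈ Metric.ball (D.pt 1) ρ → (v ∈ Λ δ ↔ m δ ≤ v.1 1))) ∧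
      (∀ K : Set ℂ, IsCompact K → K ⊆ D.carrier →
          ∀ᶠ δ : ℝ in 𝓝[>] 0, ∀ v : HexVertex, (δ : ℂ) * hexCenter v ∈ K → v ∈ Λ δ) ∧
      Tendsto (fun δ : ℝ => (δ : ℂ) * hexMidpoint (b δ)) (𝓝[>] 0) (𝓝 (D.pt 1))) →
    ∀ (x : ℂ) (e : ℝ → Sym2 HexVertex) (r : ℝ) (mr : ℝ → ℤ),
      (0 < r ∧
      D.carrier ∩ Metric.ball x r = {z : ℂ | x.im < z.im} ∩ Metric.ball x r ∧
      (∀ᶠ δ : ℝ in 𝓝[>] 0, e δ ∈ hexDomainBoundary (Λ δ) ∧ Nonempty (HexMidEdgeSAW (Λ δ) (e δ) (b δ)) ∧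
          (∀ v : HexVertex, (δ : ℂ) * hexCenter v ∈ Metric.ball x r → (v ∈ Λ δ ↔ mr δ ≤ v.1 1))) ∧
      Tendsto (fun δ : ℝ => (δ : ℂ) * hexMidpoint (e δ)) (𝓝[>] 0) (𝓝 x)) → x ≠ D.pt 1 →
    ∃ M : ℝ, ∀ᶠ δ : ℝ in 𝓝[>] 0, ∀ H : Site 2 → ℂ, IsPotential (Λ δ) (e δ) H →
      ∀ (ub wb : HexVertex), b δ = s(ub, wb) →
      ∀ sb : Site 2, sb ∈ hexFaceVertices ub → sb ∈ hexFaceVertices wb →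
      ∀ s : Site 2, IsLatticeSite (Λ δ) s → ¬ IsInteriorSite (Λ δ) s →
        δ * ((H s).re - (H sb).re) ≤
          M * ‖hexParafermionicObservable (Λ δ) (e δ) hexCriticalFugacity 0 (b δ)‖ :=
  fun D ρ Λ m b hAF x e r mr hPR hx =>
    stub_halfPlaneInputs_farReduction2 hA D ρ Λ m b hAF x e r mr hPR hx
      (hD D ρ Λ m b hAF x e r mr hPR hx)

end Summit.CriticalPhenomena.SAWScalingLimit.Theorems.PickHalfPlane.GateMass

end
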